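import Literature.Geometry.Symplectic.CompatibleMetricOrientation
import Literature.Geometry.Symplectic.NearSymplecticForms
import HarnessLib

/-!
# A non-zero self-dual `2`-form has `ω ∧ ω > 0`: self-duality in a frame forces the symplectic
# orientation of the frame

Topic `Literature/Geometry/Symplectic`; continues `CompatibleMetricOrientation.lean` (the frame
calculus `Pf(L^*α) = det L · Pf(α)` for `L ∂ⱼ = eⱼ`, there applied to `α = e⁰¹ + e²³`) and the
near-symplectic vocabulary `NearSymplecticForms.lean` (`IsWedgeSqPos o ω x`: the chart Pfaffian of
`ω x` is non-zero and `sign Pf(ω x) · [∂₀, …, ∂₃] = o x`, clause (i) of Perutz 2006, Def. 1.1).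
Everything here is PROVED; no named fact is introduced.

The linear-algebra fact behind "closed self-dual `2`-forms are symplectic off their zeros, and
near-symplectic when the zeros are transverse" (Perutz 2006, §1, the remark after Def. 1.1:
"`Λ⁺_g` is positive-definite for the wedge-product pairing"; Gerig 2021, §1: a self-dual harmonic
`2`-form "is symplectic on the complement of its zero set"; Donaldson–Kronheimer 1990, §1.1.7;
Honda 2004, §1): if the coefficient matrix `Ω_ab = α(e_a, e_b)` of a `2`-form `α` on `ℝ⁴` in some
frame `e` is SELF-DUAL as a matrix (`IsSelfDualTwo Ω`: `Ω₀₁ = Ω₂₃`, `Ω₀₂ = Ω₃₁`, `Ω₀₃ = Ω₁₂`,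
the tree's `Literature.Geometry.GaugeTheory.IsSelfDualTwo`) then the frame Pfaffian is a sum of
squares,

  `Pf_e(α) = Ω₀₁Ω₂₃ − Ω₀₂Ω₁₃ + Ω₀₃Ω₁₂ = Ω₀₁² + Ω₀₂² + Ω₀₃²`

(`framePfaffian_eq_sum_sq_of_isSelfDualTwo`), so `α ∧ α = 2 Pf_e(α) e⁰¹²³ ≥ 0` with equality iff
`α = 0` (for a basis `e`); and since `Pf_e(α) = det(e) · Pf(α)` (`det_mul_pfaffian_eq_framePfaffian`),
a non-zero such `α` has `Pf(α) ≠ 0` with the sign of `det e`: **`ω ∧ ω > 0` for an orientation `o`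
iff the frame is `o`-positive** (`isWedgeSqPos_iff_isPosFrame_of_isSelfDualTwo`), in particular
`IsWedgeSqPos o ω x` for every positively oriented `g`-orthonormal frame in which `ω x` is self-dual
(`isWedgeSqPos_of_isPosOrthonormalFrame_of_isSelfDualTwo`, the tree's gauge-theory notion
`IsPosOrthonormalFrame`).  The anti-self-dual case gives `ω ∧ ω < 0`
(`framePfaffian_eq_neg_sum_sq_of_isAntiSelfDualTwo`, `isWedgeSqPos_neg_iff_isPosFrame_of_isAntiSelfDualTwo`).

## References

* T. Perutz, *Zero-sets of near-symplectic forms*, J. Symplectic Geom. 4 (2006), Def. 1.1 and the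
  remark following it [Perutz2006].
* S. K. Donaldson, P. B. Kronheimer, *The Geometry of Four-Manifolds*, OUP (1990), §1.1.7
  [DonaldsonKronheimer1990].
* D. McDuff, D. Salamon, *Introduction to Symplectic Topology*, 3rd ed. (2017), §2.1 Cor. 2.1.4
  [McDuffSalamon2017].
-/

noncomputable section

open scoped Manifold ContDiff
open Module Literature.Geometry.Kaehler Literature.Geometry.GaugeTheory Literature.Topology.FourManifolds
open Literature.Geometry.Lorentzian (PseudoRiemannianMetric)

namespace Literature.Geometry.Symplectic

/-! ### The coefficient matrix and the Pfaffian of a `2`-form in a frame of `ℝ⁴` -/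

section Model

variable (α : (EuclideanSpace ℝ (Fin 4)) [⋀^Fin 2]→L[ℝ] ℝ) (e : Fin 4 → EuclideanSpace ℝ (Fin 4))

/-- **The coefficient matrix `Ω_ab = α(e_a, e_b)` of a `2`-form in a frame** (the matrix
`twoFormMatrix` of the tree's Seiberg–Witten files, written out to keep the imports light).
[folklore] -/
def coeffMatrix : Matrix (Fin 4) (Fin 4) ℝ :=
  Matrix.of fun a b ↦ α ![e a, e b]

/-- Entries of the coefficient matrix. [folklore] -/
@[simp] theorem coeffMatrix_apply (a b : Fin 4) : coeffMatrix α e a b = α ![e a, e b] := rfl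

/-- The coefficient matrix of a `2`-form is skew (`IsTwoForm`). [folklore] -/
theorem isTwoForm_coeffMatrix : IsTwoForm (coeffMatrix α e) := by
  ext a b
  simp only [Matrix.transpose_apply, Matrix.neg_apply, coeffMatrix_apply]
  exact alt_two_swap α (e a) (e b)

/-- **The frame Pfaffian** `Pf_e(α) = Ω₀₁Ω₂₃ − Ω₀₂Ω₁₃ + Ω₀₃Ω₁₂` (`α ∧ α = 2 Pf_e(α) e⁰¹²³` for
the dual coframe). [folklore] -/
def framePfaffian : ℝ :=
  α ![e 0, e 1] * α ![e 2, e 3] - α ![e 0, e 2] * α ![e 1, e 3] + α ![e 0, e 3] * α ![e 1, e 2]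

/-- The frame Pfaffian is the Pfaffian of the pull-back `L^*α`, `L ∂ⱼ = eⱼ`. [folklore] -/
theorem pfaffian_compContinuousLinearMap_constrL_eq_framePfaffian :
    pfaffian (α.compContinuousLinearMap ((EuclideanSpace.basisFun (Fin 4) ℝ).toBasis.constrL e)) =
      framePfaffian α e := by
  have hc : ∀ a b : Fin 4,
      (((EuclideanSpace.basisFun (Fin 4) ℝ).toBasis.constrL e :
          EuclideanSpace ℝ (Fin 4) → EuclideanSpace ℝ (Fin 4)) ∘ ![stdVec a, stdVec b]) =
        ![e a, e b] := fun a b ↦ by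
    funext k
    fin_cases k <;> simp
  simp only [pfaffian, framePfaffian, ContinuousAlternatingMap.compContinuousLinearMap_apply, hc]

/-- **`det(e) · Pf(α) = Pf_e(α)`**: the chart Pfaffian and the frame Pfaffian differ by the
determinant of the frame (`Pf(L^*α) = det L · Pf α`). [folklore] -/
theorem det_mul_pfaffian_eq_framePfaffian :
    (EuclideanSpace.basisFun (Fin 4) ℝ).toBasis.det e * pfaffian α = framePfaffian α e := by
  rw [← det_constrL, ← pfaffian_compContinuousLinearMap,
    pfaffian_compContinuousLinearMap_constrL_eq_framePfaffian]

/-- **In a frame where `α` is self-dual, `Pf_e(α) = Ω₀₁² + Ω₀₂² + Ω₀₃²`** (Perutz 2006, remark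
after Def. 1.1: `Λ⁺` is positive-definite for the wedge pairing). [cite: Perutz2006, Def. 1.1 (remark)] -/
theorem framePfaffian_eq_sum_sq_of_isSelfDualTwo (h : IsSelfDualTwo (coeffMatrix α e)) :
    framePfaffian α e = α ![e 0, e 1] ^ 2 + α ![e 0, e 2] ^ 2 + α ![e 0, e 3] ^ 2 := by
  obtain ⟨h1, h2, h3⟩ := (isSelfDualTwo_iff (isTwoForm_coeffMatrix α e)).1 h
  simp only [coeffMatrix_apply] at h1 h2 h3
  have h13 : α ![e 1, e 3] = -α ![e 3, e 1] := alt_two_swap α (e 3) (e 1)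
  simp only [framePfaffian, ← h1, h13, ← h2, ← h3]
  ring

/-- **In a frame where `α` is anti-self-dual, `Pf_e(α) = −(Ω₀₁² + Ω₀₂² + Ω₀₃²)`** (`Λ⁻` is
negative-definite for the wedge pairing). [cite: Perutz2006, Def. 1.1 (remark)] -/
theorem framePfaffian_eq_neg_sum_sq_of_isAntiSelfDualTwo (h : IsAntiSelfDualTwo (coeffMatrix α e)) :
    framePfaffian α e = -(α ![e 0, e 1] ^ 2 + α ![e 0, e 2] ^ 2 + α ![e 0, e 3] ^ 2) := by
  obtain ⟨h1, h2, h3⟩ := (isAntiSelfDualTwo_iff (isTwoForm_coeffMatrix α e)).1 h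
  simp only [coeffMatrix_apply] at h1 h2 h3
  have h13 : α ![e 1, e 3] = -α ![e 3, e 1] := alt_two_swap α (e 3) (e 1)
  have h23 : α ![e 2, e 3] = -α ![e 0, e 1] := by linarith
  have h31 : α ![e 3, e 1] = -α ![e 0, e 2] := by linarith
  have h12 : α ![e 1, e 2] = -α ![e 0, e 3] := by linarith
  simp only [framePfaffian, h13, h23, h31, h12]
  ring

variable {α e}

/-- Linearity in the first slot against a finite linear combination. [folklore] -/
private theorem alt_two_linComb_left (α : (EuclideanSpace ℝ (Fin 4)) [⋀^Fin 2]→L[ℝ] ℝ) (c : Fin 4 → ℝ)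
    (u : Fin 4 → EuclideanSpace ℝ (Fin 4)) (w : EuclideanSpace ℝ (Fin 4)) :
    α ![∑ i, c i • u i, w] = ∑ i, c i * α ![u i, w] := by
  let L : (EuclideanSpace ℝ (Fin 4)) →ₗ[ℝ] ℝ :=
    { toFun := fun u => α ![u, w]
      map_add' := fun u u' => alt_two_add_left α u u' w
      map_smul' := fun c u => alt_two_smul_left α c u w }
  have hL : ∀ u, α ![u, w] = L u := fun _ => rfl
  rw [hL, map_sum]
  refine Finset.sum_congr rfl fun i _ => ?_
  rw [map_smul, smul_eq_mul, ← hL]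

/-- A `2`-form vanishing on all pairs from a spanning frame vanishes. [folklore] -/
theorem eq_zero_of_forall_frame_eq_zero (hli : LinearIndependent ℝ e)
    (h : ∀ a b : Fin 4, α ![e a, e b] = 0) : α = 0 := by
  classical
  set b : Basis (Fin 4) ℝ (EuclideanSpace ℝ (Fin 4)) :=
    basisOfLinearIndependentOfCardEqFinrank hli (by simp) with hb
  have hbcoe : ⇑b = e := coe_basisOfLinearIndependentOfCardEqFinrank hli _
  have hexp : ∀ v : EuclideanSpace ℝ (Fin 4), v = ∑ i, b.repr v i • e i := fun v ↦ by
    conv_lhs => rw [← b.sum_repr v]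
    simp [hbcoe]
  -- `α(eᵢ, w) = 0` for every `w`, then `α(v, w) = 0` for all `v, w`
  have hew : ∀ (i : Fin 4) (w : EuclideanSpace ℝ (Fin 4)), α ![e i, w] = 0 := by
    intro i w
    rw [alt_two_swap, hexp w, alt_two_linComb_left, Finset.sum_eq_zero, neg_zero]
    intro j _
    rw [h, mul_zero]
  have hvw : ∀ v w : EuclideanSpace ℝ (Fin 4), α ![v, w] = 0 := by
    intro v w
    rw [hexp v, alt_two_linComb_left, Finset.sum_eq_zero]
    intro i _
    rw [hew, mul_zero]
  ext v
  have hv : v = ![v 0, v 1] := by funext i; fin_cases i <;> rfl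
  rw [hv]
  simpa using hvw (v 0) (v 1)

/-- **A non-zero `2`-form self-dual in a frame has positive frame Pfaffian.**
[cite: Perutz2006, Def. 1.1 (remark)] -/
theorem framePfaffian_pos_of_isSelfDualTwo (hli : LinearIndependent ℝ e)
    (h : IsSelfDualTwo (coeffMatrix α e)) (hα : α ≠ 0) : 0 < framePfaffian α e := by
  rw [framePfaffian_eq_sum_sq_of_isSelfDualTwo α e h]
  obtain ⟨h1, h2, h3⟩ := (isSelfDualTwo_iff (isTwoForm_coeffMatrix α e)).1 h
  simp only [coeffMatrix_apply] at h1 h2 h3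
  by_contra hle
  have hle' : α ![e 0, e 1] ^ 2 + α ![e 0, e 2] ^ 2 + α ![e 0, e 3] ^ 2 ≤ 0 := not_lt.1 hle
  have e01 : α ![e 0, e 1] = 0 := by nlinarith [sq_nonneg (α ![e 0, e 2]), sq_nonneg (α ![e 0, e 3])]
  have e02 : α ![e 0, e 2] = 0 := by nlinarith [sq_nonneg (α ![e 0, e 1]), sq_nonneg (α ![e 0, e 3])]
  have e03 : α ![e 0, e 3] = 0 := by nlinarith [sq_nonneg (α ![e 0, e 1]), sq_nonneg (α ![e 0, e 2])]
  refine hα (eq_zero_of_forall_frame_eq_zero hli fun a b ↦ ?_)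
  have hT := isTwoForm_coeffMatrix α e
  have hself := hT.apply_self
  have hswap := hT.apply_swap
  simp only [coeffMatrix_apply] at hself hswap
  have e23 : α ![e 2, e 3] = 0 := by rw [← h1, e01]
  have e31 : α ![e 3, e 1] = 0 := by rw [← h2, e02]
  have e12 : α ![e 1, e 2] = 0 := by rw [← h3, e03]
  fin_cases a <;> fin_cases b <;>
    simp only [Fin.zero_eta, Fin.mk_one, Fin.reduceFinMk, Fin.isValue, hself, e01, e02, e03, e23,
      e12, hswap 0 1, hswap 0 2, hswap 0 3, hswap 2 3, hswap 1 2, neg_zero] <;>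
    linarith [hswap 3 1]

/-- **A non-zero `2`-form anti-self-dual in a frame has negative frame Pfaffian.**
[cite: Perutz2006, Def. 1.1 (remark)] -/
theorem framePfaffian_neg_of_isAntiSelfDualTwo (hli : LinearIndependent ℝ e)
    (h : IsAntiSelfDualTwo (coeffMatrix α e)) (hα : α ≠ 0) : framePfaffian α e < 0 := by
  -- `-α` is self-dual in the frame `e` with the reflected last vector… simpler: redo the argument
  rw [framePfaffian_eq_neg_sum_sq_of_isAntiSelfDualTwo α e h, neg_lt_zero]
  obtain ⟨h1, h2, h3⟩ := (isAntiSelfDualTwo_iff (isTwoForm_coeffMatrix α e)).1 h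
  simp only [coeffMatrix_apply] at h1 h2 h3
  by_contra hle
  have hle' : α ![e 0, e 1] ^ 2 + α ![e 0, e 2] ^ 2 + α ![e 0, e 3] ^ 2 ≤ 0 := not_lt.1 hle
  have e01 : α ![e 0, e 1] = 0 := by nlinarith [sq_nonneg (α ![e 0, e 2]), sq_nonneg (α ![e 0, e 3])]
  have e02 : α ![e 0, e 2] = 0 := by nlinarith [sq_nonneg (α ![e 0, e 1]), sq_nonneg (α ![e 0, e 3])]
  have e03 : α ![e 0, e 3] = 0 := by nlinarith [sq_nonneg (α ![e 0, e 1]), sq_nonneg (α ![e 0, e 2])]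
  refine hα (eq_zero_of_forall_frame_eq_zero hli fun a b ↦ ?_)
  have hT := isTwoForm_coeffMatrix α e
  have hself := hT.apply_self
  have hswap := hT.apply_swap
  simp only [coeffMatrix_apply] at hself hswap
  have e23 : α ![e 2, e 3] = 0 := by linarith
  have e31 : α ![e 3, e 1] = 0 := by linarith
  have e12 : α ![e 1, e 2] = 0 := by linarith
  fin_cases a <;> fin_cases b <;>
    simp only [Fin.zero_eta, Fin.mk_one, Fin.reduceFinMk, Fin.isValue, hself, e01, e02, e03, e23,
      e12, hswap 0 1, hswap 0 2, hswap 0 3, hswap 2 3, hswap 1 2, neg_zero] <;>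
    linarith [hswap 3 1]

/-! ### Orientation: `ω ∧ ω > 0` for `o` iff the self-dual frame is `o`-positive -/

/-- `signOrientationIn n (-t) = -signOrientationIn n t` for `t ≠ 0`. [folklore] -/
theorem signOrientationIn_neg {n : ℕ} {t : ℝ} (ht : t ≠ 0) :
    signOrientationIn n (-t) = -signOrientationIn n t := by
  unfold signOrientationIn
  rcases lt_or_gt_of_ne ht with h | h
  · rw [if_pos (neg_pos.2 h), if_neg (not_lt.2 h.le)]
    exact (neg_neg (euclideanOrientation n)).symm
  · rw [if_neg (not_lt.2 (neg_nonpos.2 h.le)), if_pos h]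

variable {N : Type*} [TopologicalSpace N] [ChartedSpace (EuclideanSpace ℝ (Fin 4)) N]
  [IsManifold (𝓡 4) ∞ N]

/-- **A frame of `ℝ⁴` is `o`-positive at `x` iff `o x = sign(det e) · [∂₀, …, ∂₃]`** (the
determinant taken in the standard basis). [folklore] -/
theorem isPosFrame_iff_eq_signOrientationIn_det (o : SmoothOrientation (𝓡 4) N) (x : N)
    (hli : LinearIndependent ℝ e) :
    o.IsPosFrame x (e ∘ finCongr finrank_euclideanSpace_fin) ↔
      o x = signOrientationIn 4 ((EuclideanSpace.basisFun (Fin 4) ℝ).toBasis.det e) := by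
  classical
  set σ : Fin (finrank ℝ (EuclideanSpace ℝ (Fin 4))) ≃ Fin 4 := finCongr finrank_euclideanSpace_fin
    with hσ
  set b : Basis (Fin 4) ℝ (EuclideanSpace ℝ (Fin 4)) :=
    basisOfLinearIndependentOfCardEqFinrank hli (by simp) with hb
  have hbcoe : ⇑b = e := coe_basisOfLinearIndependentOfCardEqFinrank hli _
  set b' : Basis (Fin (finrank ℝ (EuclideanSpace ℝ (Fin 4)))) ℝ (EuclideanSpace ℝ (Fin 4)) :=
    b.reindex σ.symm with hb'
  have hb'coe : ⇑b' = e ∘ σ := by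
    funext i; rw [hb', Basis.reindex_apply, Equiv.symm_symm, hbcoe]; rfl
  rw [← hb'coe, SmoothOrientation.isPosFrame_iff_orientation_eq]
  set std := (EuclideanSpace.basisFun (Fin 4) ℝ).toBasis with hstd
  have heucl : euclideanOrientation 4 = (std.reindex σ.symm).orientation := rfl
  have hdet : (std.reindex σ.symm).det b' = std.det e := by
    rw [hb'coe, Basis.det_reindex_symm]
  have hdet0 : std.det e ≠ 0 := by
    rw [← hbcoe]; exact (std.isUnit_det b).ne_zero
  -- the orientation of `b'` is `sign(det e) · [∂₀, …, ∂₃]`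
  have hb'or : b'.orientation = signOrientationIn 4 (std.det e) := by
    unfold signOrientationIn
    by_cases hd : 0 < std.det e
    · rw [if_pos hd, heucl, eq_comm, Basis.orientation_eq_iff_det_pos, hdet]
      exact hd
    · rw [if_neg hd, heucl]
      refine ((std.reindex σ.symm).orientation_ne_iff_eq_neg _).1 fun heq ↦ hd ?_
      rw [eq_comm, Basis.orientation_eq_iff_det_pos, hdet] at heq
      exact heq
  rw [hb'or]
  exact eq_comm

/-- **Sign bookkeeping**: if `det(e) · Pf(α) > 0`, then `e` is `o`-positive at `x` iff
`o x = sign Pf(α) · [∂₀, …, ∂₃]`. [cite: McDuffSalamon2017, §2.1 Cor. 2.1.4] -/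
theorem isPosFrame_iff_eq_signOrientationIn_of_det_mul_pfaffian_pos (o : SmoothOrientation (𝓡 4) N)
    (x : N) (hli : LinearIndependent ℝ e)
    (hpos : 0 < (EuclideanSpace.basisFun (Fin 4) ℝ).toBasis.det e * pfaffian α) :
    o.IsPosFrame x (e ∘ finCongr finrank_euclideanSpace_fin) ↔
      o x = signOrientationIn 4 (pfaffian α) := by
  rw [isPosFrame_iff_eq_signOrientationIn_det o x hli]
  have h : signOrientationIn 4 ((EuclideanSpace.basisFun (Fin 4) ℝ).toBasis.det e) =
      signOrientationIn 4 (pfaffian α) :=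
    signOrientationIn_eq_iff.2 (pos_iff_pos_of_mul_pos hpos)
  rw [h]

/-- … and if `det(e) · Pf(α) < 0`, then `e` is `o`-positive at `x` iff
`o x = sign(-Pf α) · [∂₀, …, ∂₃]`. [cite: McDuffSalamon2017, §2.1 Cor. 2.1.4] -/
theorem isPosFrame_iff_eq_signOrientationIn_of_det_mul_pfaffian_neg (o : SmoothOrientation (𝓡 4) N)
    (x : N) (hli : LinearIndependent ℝ e)
    (hneg : (EuclideanSpace.basisFun (Fin 4) ℝ).toBasis.det e * pfaffian α < 0) :
    o.IsPosFrame x (e ∘ finCongr finrank_euclideanSpace_fin) ↔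
      o x = signOrientationIn 4 (-pfaffian α) := by
  rw [isPosFrame_iff_eq_signOrientationIn_det o x hli]
  have hpos : 0 < (EuclideanSpace.basisFun (Fin 4) ℝ).toBasis.det e * (-pfaffian α) := by
    rw [mul_neg]; exact neg_pos.2 hneg
  have h : signOrientationIn 4 ((EuclideanSpace.basisFun (Fin 4) ℝ).toBasis.det e) =
      signOrientationIn 4 (-pfaffian α) :=
    signOrientationIn_eq_iff.2 (pos_iff_pos_of_mul_pos hpos)
  rw [h]

/-- **A `2`-form self-dual and non-zero in a frame has `ω ∧ ω > 0` exactly for the orientation of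
the frame**: for a `2`-form `ω` on a `4`-manifold, a point `x` and a frame `e` of `T_x N` (read in
the preferred chart) in which the matrix of `ω x` is self-dual and non-zero,
`IsWedgeSqPos o s x ↔ e is o-positive`. [cite: Perutz2006, Def. 1.1 (remark)] -/
theorem isWedgeSqPos_iff_isPosFrame_of_isSelfDualTwo (o : SmoothOrientation (𝓡 4) N)
    (s : MForm (𝓡 4) N ℝ 2) (x : N) {e : Fin 4 → TangentSpace (𝓡 4) x}
    (hli : LinearIndependent ℝ e) (hSD : IsSelfDualTwo (coeffMatrix (s x) e)) (hne : s x ≠ 0) :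
    IsWedgeSqPos o s x ↔ o.IsPosFrame x (e ∘ finCongr finrank_euclideanSpace_fin) := by
  have hpos : 0 < (EuclideanSpace.basisFun (Fin 4) ℝ).toBasis.det e * pfaffian (s x) := by
    rw [det_mul_pfaffian_eq_framePfaffian]
    exact framePfaffian_pos_of_isSelfDualTwo hli hSD hne
  have hpf : pfaffian (s x) ≠ 0 := by
    intro h0; rw [h0, mul_zero] at hpos; exact lt_irrefl 0 hpos
  rw [isPosFrame_iff_eq_signOrientationIn_of_det_mul_pfaffian_pos o x hli hpos]
  exact ⟨fun h ↦ h.2, fun h ↦ ⟨hpf, h⟩⟩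

/-- In particular **`ω ∧ ω > 0` at `x` for `o` whenever `ω x ≠ 0` is self-dual in some
`o`-positive frame** (Perutz 2006, remark after Def. 1.1; Gerig 2021, §1: a self-dual `2`-form is
symplectic off its zeros, with the given orientation). [cite: Perutz2006, Def. 1.1 (remark)] -/
theorem isWedgeSqPos_of_isPosFrame_of_isSelfDualTwo (o : SmoothOrientation (𝓡 4) N)
    (s : MForm (𝓡 4) N ℝ 2) (x : N) {e : Fin 4 → TangentSpace (𝓡 4) x}
    (hli : LinearIndependent ℝ e) (hpos : o.IsPosFrame x (e ∘ finCongr finrank_euclideanSpace_fin))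
    (hSD : IsSelfDualTwo (coeffMatrix (s x) e)) (hne : s x ≠ 0) : IsWedgeSqPos o s x :=
  (isWedgeSqPos_iff_isPosFrame_of_isSelfDualTwo o s x hli hSD hne).2 hpos

/-- **Anti-self-dual version**: if the matrix of `ω x` in the frame `e` is anti-self-dual and
non-zero, then `ω ∧ ω > 0` for the OPPOSITE orientation exactly when `e` is `o`-positive:
`IsWedgeSqPos (-o) s x ↔ e is o-positive` (so `ω ∧ ω < 0` on `o`-positive frames, and
`¬ IsWedgeSqPos o ω x`). [cite: Perutz2006, Def. 1.1 (remark)] -/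
theorem isWedgeSqPos_neg_iff_isPosFrame_of_isAntiSelfDualTwo (o : SmoothOrientation (𝓡 4) N)
    (s : MForm (𝓡 4) N ℝ 2) (x : N) {e : Fin 4 → TangentSpace (𝓡 4) x}
    (hli : LinearIndependent ℝ e) (hASD : IsAntiSelfDualTwo (coeffMatrix (s x) e)) (hne : s x ≠ 0) :
    IsWedgeSqPos (-o) s x ↔ o.IsPosFrame x (e ∘ finCongr finrank_euclideanSpace_fin) := by
  have hneg : (EuclideanSpace.basisFun (Fin 4) ℝ).toBasis.det e * pfaffian (s x) < 0 := by
    rw [det_mul_pfaffian_eq_framePfaffian]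
    exact framePfaffian_neg_of_isAntiSelfDualTwo hli hASD hne
  have hpf : pfaffian (s x) ≠ 0 := by
    intro h0; rw [h0, mul_zero] at hneg; exact lt_irrefl 0 hneg
  rw [isPosFrame_iff_eq_signOrientationIn_of_det_mul_pfaffian_neg o x hli hneg,
    signOrientationIn_neg hpf]
  unfold IsWedgeSqPos
  rw [SmoothOrientation.neg_apply]
  constructor
  · rintro ⟨-, h⟩
    rw [← h]
    exact (neg_neg (o x)).symm
  · intro h
    refine ⟨hpf, ?_⟩
    rw [h]
    exact neg_neg (signOrientationIn 4 (pfaffian (s x)))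

/-! ### With a metric: positively oriented orthonormal frames -/

/-- **For a positively oriented `g`-orthonormal frame in which `ω x` is self-dual and non-zero,
`ω ∧ ω > 0`** — the pointwise half of "a self-dual `2`-form (for `g`, `o`) is near-positive off its
zeros, hence symplectic there with the orientation `o`" (Perutz 2006, remark after Def. 1.1;
Gerig 2021, §1; Donaldson–Kronheimer 1990, §1.1.7), over the tree's gauge-theory notion
`IsPosOrthonormalFrame g o x e`. [cite: Perutz2006, Def. 1.1 (remark)] -/
theorem isWedgeSqPos_of_isPosOrthonormalFrame_of_isSelfDualTwo
    (g : PseudoRiemannianMetric (𝓡 4) ∞ (EuclideanSpace ℝ (Fin 4)) (TangentSpace (𝓡 4) : N → Type _)) (o : SmoothOrientation (𝓡 4) N)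
    (s : MForm (𝓡 4) N ℝ 2) (x : N) {e : Fin 4 → TangentSpace (𝓡 4) x}
    (he : IsPosOrthonormalFrame g o x e) (hSD : IsSelfDualTwo (coeffMatrix (s x) e))
    (hne : s x ≠ 0) : IsWedgeSqPos o s x :=
  isWedgeSqPos_of_isPosFrame_of_isSelfDualTwo o s x (linearIndependent_of_isOrthonormalFrame _ he.1)
    he.2 hSD hne

end Model

end Literature.Geometry.Symplectic

end
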